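import Literature.NumberTheory.EllipticCurves.LocalEulerCharacteristicTorsion
import Literature.NumberTheory.EllipticCurves.SelmerLocalRestrictionKernel
import Literature.NumberTheory.GaloisRepresentations.GaloisCohomologyKummerProofs
import Literature.NumberTheory.GaloisRepresentations.ModNCyclotomicCharacter
import Literature.NumberTheory.GaloisRepresentations.LocalDualityDescent
import HarnessLib

/-!
# Route `PrintCFram`, crux C2 `BottomClassIndexLawFiveLe` (stmt-BirchSwinnertonDyer-20372), line
# `eisenstein-resource-bdp-line` (registry v19, stub B1 `stub_bsdp_of_classFactor`): **THE LOCAL LINE COUNT `#H¹(ℚ_v, A) = p`** for a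
# character module of order `p` ramified at `p` and not cyclotomic there, from Tate's local Euler characteristic
# (cell `bsd-print-cfram`, width seat `bsd-line-cfram-p1-w2` g10; helper `--supports` 20372; 0 defs, 0 facts, 0 sorry;
# CONDITIONAL on the tree's named fact `localEulerPoincareCharacteristic ℚ_v`, Milne I Thm 2.8)

HONEST FRAMING. Nothing about BSD is proved here and no stub is closed. This is the local input of the sequel
`…SelmerCountCoalignedOfLocal` ((LA) ⟹ CO-ALIGNED: «two lines in the plane `H¹(ℚ_v, W[p])`»): the image of `H¹(ℚ_v, Φ)` has at most
`p` elements because `H¹(ℚ_v, Φ)` has exactly `p` — Tate's local Euler–Poincaré characteristic `#H⁰ · #H² · #(ℤ_v/p) = #H¹` (the tree's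
NAMED FACT `localEulerPoincareCharacteristic`, Milne I Thm 2.8, used the same way by `LocalEulerCharacteristicTorsion.lean` for `W[n]`) with
`H⁰ = 0`, `#H² = #Hom_{Γ_v}(A, μ_p)` (the tree's THEOREM `natCard_two_eq_natCard_invariants_homRep`, local duality in bidegree `(2,0)`)
`= 1`, and `#(ℤ_v/p) = p`.

* §0 `modNCyclotomicCharacter_adicCompletion_eq` — `χ̄_p` of `ℚ_v` at `σ` is `χ̄_p` of `ℚ` at `res σ` (the chosen embedding carries `μ_p(ℚ̄)`
  to `μ_p(\bar ℚ_v)` compatibly, `absGaloisRestrict_apply_smul`); `mu_adicCompletion_apply` — `σ` acts on the module `mu ℚ_v p` by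
  `χ̄_p(res σ)`.
* §1 **`natCard_galoisCohomology_one_eq_prime_of_localEuler`** — `ρ : DiscreteGaloisModule ℚ_v A`, `#A = p`, no non-zero `Γ_v`-invariant,
  no non-zero `Γ_v`-equivariant `A → μ_p`, `localEulerPoincareCharacteristic ℚ_v` ⊢ `H¹(ℚ_v, A)` is finite of order `p`.

THEOREMS ONLY; no definition, no named fact, no `sorry`. BSD is not proved by any of this; no summit statement is proved by this seat.
References: [MilneADT2006] I Thm. 2.8 (p. 31), Cor. 2.3; [SerreGaloisCohomology1997] II §5.2 Thm. 2, §5.7 Thm. 5.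
-/

set_option autoImplicit false
-- `…BirchSwinnertonDyer.BirchSwinnertonDyer.Theorems…` is the problem's mandated namespace (D-0017).
set_option linter.dupNamespace false

noncomputable section

open scoped Classical

namespace Summit.BirchSwinnertonDyer.BirchSwinnertonDyer.Theorems.PrintCFram.SelmerCount

open NumberField IsDedekindDomain Field WeierstrassCurve
open Literature.NumberTheory.EllipticCurves Literature.NumberTheory.GaloisRepresentations
open Literature.NumberTheory.GaloisRepresentations.DiscreteGaloisModule (mu MuCarrier)
open scoped ContRepresentation

/-! ## §0 The cyclotomic character at the completion -/

section Cyclotomic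

variable {p : ℕ} [hp : Fact p.Prime] (v : HeightOneSpectrum (𝓞 ℚ))

/-- **`χ̄_p` of `ℚ_v` at `σ` is `χ̄_p` of `ℚ` at `res σ`**: the chosen embedding `ℚ̄ → \bar ℚ_v` carries the `p`-th roots of unity
of `ℚ̄` onto those of `\bar ℚ_v` compatibly with `res` (`absGaloisRestrict_apply_smul`). [folklore] -/
theorem modNCyclotomicCharacter_adicCompletion_eq [NeZero ((p : ℕ) : v.adicCompletion ℚ)]
    (σ : absoluteGaloisGroup (v.adicCompletion ℚ)) :
    (modNCyclotomicCharacter (v.adicCompletion ℚ) p σ : ZMod p) =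
      (modNCyclotomicCharacter ℚ p (absGaloisRestrict ℚ (v.adicCompletion ℚ) σ) : ZMod p) := by
  haveI : NeZero p := ⟨hp.out.ne_zero⟩
  -- a primitive `p`-th root of unity of `ℚ̄` and its image in `\bar ℚ_v`
  obtain ⟨ζ₀, hζ₀⟩ := HasEnoughRootsOfUnity.exists_primitiveRoot (AlgebraicClosure ℚ) p
  have hζ : IsPrimitiveRoot (absClosureEmbedding ℚ (v.adicCompletion ℚ) ζ₀) p :=
    hζ₀.map_of_injective (absClosureEmbedding ℚ (v.adicCompletion ℚ)).toRingHom.injective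
  have hsmul : σ • absClosureEmbedding ℚ (v.adicCompletion ℚ) ζ₀ = absClosureEmbedding ℚ (v.adicCompletion ℚ) ζ₀ ^
      ((modNCyclotomicCharacter ℚ p (absGaloisRestrict ℚ (v.adicCompletion ℚ) σ) : ZMod p)).val := by
    rw [← absGaloisRestrict_apply_smul, modNCyclotomicCharacter_spec ℚ p _ ζ₀ hζ₀.pow_eq_one, map_pow]
  rw [modNCyclotomicCharacter_eq_of_smul_eq_pow (v.adicCompletion ℚ) p hζ σ hsmul, ZMod.natCast_zmod_val]

/-- The action of `σ ∈ Γ_{ℚ_v}` on `μ_p(\bar ℚ_v)` (the module `mu ℚ_v p`, written additively) is multiplication by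
`χ̄_p(res σ)`. [folklore] -/
theorem mu_adicCompletion_apply (σ : absoluteGaloisGroup (v.adicCompletion ℚ)) (x : MuCarrier (v.adicCompletion ℚ) p) :
    mu (v.adicCompletion ℚ) p σ x =
      ((modNCyclotomicCharacter ℚ p (absGaloisRestrict ℚ (v.adicCompletion ℚ) σ) : ZMod p)).val • x := by
  haveI : NeZero p := ⟨hp.out.ne_zero⟩
  -- (`CharZero ℚ_v` is NOT registered as a local instance: it would let `DivisionRing.toRatAlgebra` compete with the place's own
  -- `ℚ`-algebra structure inside `absGaloisRestrict ℚ ℚ_v`; w6 g3's lesson.)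
  haveI : NeZero ((p : ℕ) : v.adicCompletion ℚ) :=
    ⟨(@Nat.cast_ne_zero (v.adicCompletion ℚ) _ (charZero_adicCompletion v) p).mpr hp.out.ne_zero⟩
  apply muVal_injective (v.adicCompletion ℚ) p
  rw [muVal_apply, muVal_nsmul]
  apply Units.ext
  have h1 : ((muVal (v.adicCompletion ℚ) p x : (AlgebraicClosure (v.adicCompletion ℚ))ˣ) :
      AlgebraicClosure (v.adicCompletion ℚ)) ^ p = 1 := by
    rw [← Units.val_pow_eq_pow_val, muVal_pow_eq_one, Units.val_one]
  have hval : ((modNCyclotomicCharacter (v.adicCompletion ℚ) p σ : ZMod p)).val =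
      ((modNCyclotomicCharacter ℚ p (absGaloisRestrict ℚ (v.adicCompletion ℚ) σ) : ZMod p)).val := by
    rw [modNCyclotomicCharacter_adicCompletion_eq]
  rw [Units.val_pow_eq_pow_val, Units.coe_smul, modNCyclotomicCharacter_spec (v.adicCompletion ℚ) p σ _ h1, hval]

end Cyclotomic

/-! ## §1 The local count: `#H¹(ℚ_v, A) = p` for a character module of order `p` with `A^{Γ_v} = 0 = Hom_{Γ_v}(A, μ_p)` -/

section LocalCount

variable {p : ℕ} [hp : Fact p.Prime] (v : HeightOneSpectrum (𝓞 ℚ))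
variable {A : Type} [AddCommGroup A] [TopologicalSpace A] [DiscreteTopology A] [Finite A]

/-- **`#H¹(ℚ_v, A) = p`.** `F = ℚ_v` (`v ∋ p`), `A` a finite discrete `Γ_F`-module of order `p` with no non-zero `Γ_F`-invariant
and no non-zero `Γ_F`-equivariant homomorphism `A → μ_p` (i.e. `H⁰(F, A) = 0 = H⁰(F, A^D)`); ASSUME Tate's local Euler–Poincaré
characteristic formula for `F` (the tree's named fact `localEulerPoincareCharacteristic F`, Milne I Thm 2.8). THEN `H¹(F, A)` is finite
of order exactly `p`: `#H⁰ · #H² · #(ℤ_v/p) = #H¹` with `#H² = #Hom_{Γ_F}(A, μ_p)` (local duality in bidegree `(2,0)`, tree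
`natCard_two_eq_natCard_invariants_homRep`) and `#(ℤ_v/p) = p`. [cite: MilneADT2006, Ch. I §2, Thm. 2.8 and Cor. 2.3]
[cite: SerreGaloisCohomology1997, II §5.7 Thm. 5] -/
theorem natCard_galoisCohomology_one_eq_prime_of_localEuler (hpv : ((p : ℕ) : 𝓞 ℚ) ∈ v.asIdeal)
    (hEP : localEulerPoincareCharacteristic (v.adicCompletion ℚ))
    (ρ : DiscreteGaloisModule (v.adicCompletion ℚ) A) (hA : Nat.card A = p)
    (hinv : ∀ a : A, (∀ σ : absoluteGaloisGroup (v.adicCompletion ℚ), ρ σ a = a) → a = 0)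
    (hdual : ∀ f : HomCarrier A (MuCarrier (v.adicCompletion ℚ) p),
      (∀ (σ : absoluteGaloisGroup (v.adicCompletion ℚ)) (a : A), mu (v.adicCompletion ℚ) p σ (f a) = f (ρ σ a)) → f = 0) :
    Finite (galoisCohomology ρ 1) ∧ Nat.card (galoisCohomology ρ 1) = p := by
  -- (`H²` needs `LocallyCompactSpace Γ_v`: the compactness of the absolute Galois group, as an instance local to this proof)
  haveI := absoluteGaloisGroup_compactSpace (v.adicCompletion ℚ)
  obtain ⟨h1fin, -, hEq⟩ := localEulerPoincareCharacteristic_adicCompletion ℚ v hEP ρ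
  refine ⟨h1fin, ?_⟩
  -- `#H⁰ = 1`
  have h0 : Nat.card ρ.toTopRep.ρ.invariants = 1 := by
    rw [Nat.card_eq_one_iff_unique]
    refine ⟨⟨fun x y ↦ Subtype.ext ((hinv x.1 fun σ ↦ x.2 σ).trans (hinv y.1 fun σ ↦ y.2 σ).symm)⟩, ⟨0⟩⟩
  -- `#H² = #Hom_Γ(A, μ_p) = 1`
  have hM : ∀ a : A, p ^ 1 • a = 0 := fun a ↦ by rw [pow_one, ← hA]; exact card_nsmul_eq_zero'
  haveI : CharZero (v.adicCompletion ℚ) := charZero_adicCompletion v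
  obtain ⟨-, h2⟩ := natCard_two_eq_natCard_invariants_homRep (v.adicCompletion ℚ) ρ hM
  rw [pow_one] at h2
  have h2' : Nat.card (ρ.homRep (mu (v.adicCompletion ℚ) p)).toTopRep.ρ.invariants = 1 := by
    rw [Nat.card_eq_one_iff_unique]
    refine ⟨⟨fun f g ↦ Subtype.ext ?_⟩, ⟨0⟩⟩
    have hf : f.1 = 0 := hdual f.1 fun σ a ↦ ((ContinuousRep.homRep_apply_eq_self_iff ρ (mu (v.adicCompletion ℚ) p) σ f.1).1 (f.2 σ)) a
    have hg : g.1 = 0 := hdual g.1 fun σ a ↦ ((ContinuousRep.homRep_apply_eq_self_iff ρ (mu (v.adicCompletion ℚ) p) σ g.1).1 (g.2 σ)) a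
    rw [hf, hg]
  -- `#(ℤ_v / p) = p`
  have hq : Nat.card (v.adicCompletionIntegers ℚ ⧸ Ideal.span {((Nat.card A : ℕ) : v.adicCompletionIntegers ℚ)}) = p := by
    rw [hA]; exact natCard_adicCompletionIntegers_quot_span_prime hpv
  change Nat.card ρ.toTopRep.ρ.invariants * Nat.card (continuousCohomology 2 ρ.toTopRep) * _ =
    Nat.card (continuousCohomology 1 ρ.toTopRep) at hEq
  rw [h0, h2, h2', hq, one_mul, one_mul] at hEq
  exact hEq.symm

end LocalCount

end Summit.BirchSwinnertonDyer.BirchSwinnertonDyer.Theorems.PrintCFram.SelmerCount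

end
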